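import Literature.MathematicalPhysics.QuantumFieldTheory.Balaban1983to89.B15Prop1JointHolomorphyFromMinimiserFamilyOneSided
import Literature.MathematicalPhysics.QuantumFieldTheory.Balaban1983to89.B15Prop1JointHolomorphyFromMinimiserFamily

/-!
# `Balaban1983to89.B15Prop1ClosedGuardUniformRadius` — [Balaban1989LargeFieldI] = «[IV]», (1.74) p. 192, Prop. 1 p. 194 (last clause «analytic function of B′,
# e.g., |B′| < ε»); [Balaban1985Variational] = «[15]», (7) p. 278, Prop. 9 (190) p. 309; [Balaban1988Convergent] = «[III]», (2.12) p. 256: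
# ★★★ PROPOSITION 1 [IV] AT PRINT'S (1.74) OBJECT WITH THE CONFIGURATION LETTER (J0′) IN ITS COMPACT-UNIFORM FORM — ONE RADIUS PER INSTANCE ON THE CLOSED
# SMALL-FIELD GUARD, THE RADIUS EXISTENTIAL, THE CURRENT CONSTANT `cJ` ABSORBED (finite instance index)

Honest framing: statement-level skeleton of published theorems with citation tags; proofs where landed; nothing here is a claim about the
Yang–Mills mass gap.  Cell `pub-ymgap`, HUMAN RULING D-0062 ∕ D-0149, seat `pub-ymgap-dag-n12-c` (g17; N12 = [B15], strategy s1, lane owner); count-neutral helper of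
K1⁷; N12 NOT discharged; finite 𝕋⁴ at fixed ε; nothing continuum ∕ OS ∕ mass-gap ∕ Clay.

WHY.  The N12∕s1 endpoints of record — dag-n12-w1's `B15Prop1JointHolomorphyFromMinimiserFamilyOneSided.…_ofMinimiserFamily_oneSided` (p589595, the one-sided
(1.7) edition) and `B15Prop1JointHolomorphyFromMinimiserFamily.…_ofMinimiserFamily` (p586362, two-sided) — read the intrinsic configuration letter (J0′) `hMin` with a
NAMED radius `R i` per instance: for every `eR i`-regular base field `V_k` (print's (1.74) guard, the STRICT `PlaqSmallOn`) ONE family of bond matrices on the sup-ball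
`ball 0 (R i)`, holomorphic, bounded by `𝓐₀ i`, equal at real points to a (2.12) minimiser.  The w1 lineage PRODUCES this letter from local holomorphic charts by
COMPACTNESS of the set of base fields (`B15Prop1MinimiserFamilyPatching.hMin_of_localCharts` p595389, `B15Prop1CriticalChartFromIFT.hMin_of_criticalFamilies`,
and its successor «(J0′) from base-field letters»): the output is `∃ R > 0, ∀ V_k ∈ K, …` for a compact `K` — the radius is EXISTENTIAL and not explicit.  Two things
then have to be said once, and this module says them: (i) the guard set of the endpoint is the STRICT shell `{|V_k(∂p) − 1| < eR}` (open); its closure-side companion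
`{|V_k(∂p) − 1| ≤ eR}` is CLOSED in the compact configuration space `(bonds → SU(2))`, hence compact, and contains the guard — so the compact-uniform letter ON THE
CLOSED GUARD serves the endpoint's `hMin` verbatim; (ii) the endpoint's bookkeeping letter `hcJ'` (`2cA·eR∕R + 4|Plaq|(1+8𝓐₀⁴)∕(R·eR) ≤ cJ`, the current bound feeding
print's instance-independent `B₅` of (1.78)) mentions `R i`; with `R i` existential it can only be met uniformly when the instance index is FINITE (on one finite lattice
the instances `(Z, Λ^{(k)}, k, M)` of [IV] Prop. 1 form a finite set) — then `cJ := max_i (…)` and the letter DISAPPEARS.  Print's radius is explicit (from the contraction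
(1.13) p. 359); the compactness route trades it for `Finite ι`, displayed as a binder.

CONTENTS (theorems only; no `def`, no `instance`, no `sorry`).
* §1 `plaqLeOn_of_plaqSmallOn`, `isClosed_setOf_plaqLeOn`, ★ `isCompact_setOf_plaqLeOn` (the closed small-field guard on a plaquette set is compact in `GaugeField P j SU2`),
  `forall_of_forall_isCompact_subset` (a compact-uniform letter specialises to the closed guard).
* §2 (private) `exists_forall_le_of_finite` (a real family over a finite index has a nonnegative upper bound) [folklore].
* §3 ★★★ `exists_domain_prop1Printed_lfVarOn_std_su2_box_intrinsic_analytic_atZSeqCoPRecord_ofThm1TorusClass_ofMinimiserFamilyUniform_oneSided` — p589595 with `hMin` in the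
  compact-uniform form on the CLOSED guard (`hMinK : ∀ i, ∃ R > 0, ∀ V_k, (∀ p, |V_k(∂p) − 1| ≤ eR i) → …`), `R` and `hcJ'`∕`cJ` REMOVED from the binders, `[Finite ι]` added;
  conclusion `∃ R, (∀ i, 0 < R i) ∧ ∃ a₁, … Prop1Printed …` (the radius now produced).  ★★★ `…_ofMinimiserFamilyUniform` — the two-sided twin over p586362.
* §4 ★★★ `…_ofMinimiserFamilyCompact_oneSided` ∕ `…_ofMinimiserFamilyCompact` — the same with the letter in the w1 lineage's OUTPUT SHAPE «for every compact `K` inside the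
  closed guard, `∃ R > 0, ∀ V_k ∈ K, …`» (consumed: `hMin_of_localCharts` ∕ `hMin_of_criticalFamilies` ∕ their successor at `K :=` the closed guard, one line each).
HONEST SCOPE: point-set topology and bookkeeping around the landed endpoints; every analytic ∕ variational letter ((J0′) in either form, (L2) `h17`∕`hlead`, `h15T`, …) stays
DISPLAYED; nothing of Bałaban's is asserted.
-/

noncomputable section

open Set Finset Metric
open scoped BigOperators Matrix RealInnerProductSpace Real InnerProductSpace

namespace Literature.MathematicalPhysics.QuantumFieldTheory.Balaban1983to89.B15Prop1ClosedGuardUniformRadius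


open B15DeterminingSets GaugeField B16Sect1Backgrounds B15Prop1Carrier B8Eq17ClassAkV1 BlockAveraging
open B15Prop1SliceTaylorCalculus B15Prop1IntrinsicAnalyticExt B15Prop1ParametricZeroBranch B15Prop1LocalLettersOfFun B15Prop1IntrinsicOfFun
open B15Prop1IntrinsicOfRecord B15Prop1GradientFromNearValue B15Prop1GradientFromNearValueAtCoPRecord
open B15Prop1AtZSequenceRecord B15Prop1DatumSmall7AtZSequence B15Prop1Thm1GeneralFormAtZSequence B15Prop1Thm1GeneralFormShapes
open B15Prop1JointHolomorphyFromBackground B15Prop1OneSidedIneq17OfFun B15Prop1OneSidedIneq17Edition B15Prop1ValueOfAnyMinimiser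
open B15Prop1JointHolomorphyFromMinimiserFamilyOneSided B15Prop1JointHolomorphyFromMinimiserFamily
open B15Prop1AnalyticExtClause (cplxVec cplxSlice cplxSlice_apply norm_cplxSlice norm_cplxVec reSlice anExt anExt_antitone)
open B15Prop1ChartCalculusSU2 (E3)
open T4CubeChartGnomonic (SU2)
open B15Prop1ChartSU2 (su2Chart)
open B15Prop1SliceCoordinates (GaugeSlice ιA freeBonds norm_ιA_apply_le)
open T4AxialGaugeSmallField (castSite boxPlaqs)
open T4AxialGaugeFixing (TreeOrder boxDepth)
open B7Prop1Explicit (e e_apply)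
open B6BondElimination (unitVec)
open B6TreeGaugePoincare (curl)
open B16Eq18Proof (box mem_box)
open B15Extension193 (extend)
open B15ShellGauge193 (shellGauge)
open B5Bounds167Lattice (formDk ofRealCfg)
open B14DomainGeom (IsUnionOfCubes)
open B15Eq112TorusCover (cover)
open B14.Eq213MaximalDomains (side)
open B14.Eq213DetSet B14.Eq216Concrete B15Sect1Instances B15Eq177GaugeInvariance B15Eq177ValueInvariance B15Eq177ValueInvarianceCoDiv B16Sect1Wilson
open B14.Eq22Determines (blockIter IsBlockUnion)
open Literature.MathematicalPhysics.QuantumFieldTheory.BalabanImbrieJaffe1984to88.BIJ85Eq453GaugeField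
open B11Prop6Scheme (Prop4Hyp)
open T4Continuum
open Classical


/-! ## §1  The closed small-field guard is compact -/

section ClosedGuard

variable {P : Params} {j : ℕ}

/-- `|· − 1|` is continuous on `SU(2)` (private copy of `B12ContinuousTransportInvarianceOn.continuous_dist1_SU`, not to import that chain). [folklore] -/
private theorem continuous_dist1_SU2 : Continuous (dist1 : SU2 → ℝ) :=
  UnitaryModel.continuous_opDist1.comp (Literature.MathematicalPhysics.QuantumLattice.continuous_fundamentalRep (Fin 2))

/-- Plaquette variables are continuous in the configuration (private copy of `B12ContinuousTransportInvarianceOn.continuous_plaqHol_SU`). [folklore] -/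
private theorem continuous_plaqHol_SU2 (p : Plaq P j) : Continuous fun U : GaugeField P j SU2 => GaugeField.plaqHol U p := by
  have hb : ∀ b : PBond P j, Continuous fun U : GaugeField P j SU2 => U b := fun b => continuous_apply b
  unfold GaugeField.plaqHol
  exact (((hb _).mul (hb _)).mul (hb _).inv).mul (hb _).inv

/-- The STRICT small-field guard of print's (1.74) ∕ [15] (7) (`PlaqSmallOn`, `<`) implies its closed companion (`≤`) on the same plaquette set.
[cite: Balaban1989LargeFieldI, (1.74) p.192; Balaban1985Variational, (7) p.278] -/
theorem plaqLeOn_of_plaqSmallOn {S : Set (Plaq P j)} {δ : ℝ} {U : GaugeField P j SU2} (h : PlaqSmallOn S δ U) :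
    ∀ p ∈ S, dist1 (GaugeField.plaqHol U p) ≤ δ :=
  fun p hp => le_of_lt (h p hp)

/-- The closed small-field guard `{U | ∀ p ∈ S, |U(∂p) − 1| ≤ δ}` is a closed subset of the configuration space `GaugeField P j SU2` (finitely many non-strict
inequalities between continuous functions). [cite: Balaban1989LargeFieldI, (1.74) p.192; Balaban1985Variational, (7) p.278] -/
theorem isClosed_setOf_plaqLeOn (S : Set (Plaq P j)) (δ : ℝ) :
    IsClosed {U : GaugeField P j SU2 | ∀ p ∈ S, dist1 (GaugeField.plaqHol U p) ≤ δ} := by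
  have h : {U : GaugeField P j SU2 | ∀ p ∈ S, dist1 (GaugeField.plaqHol U p) ≤ δ} =
      ⋂ p ∈ S, {U : GaugeField P j SU2 | dist1 (GaugeField.plaqHol U p) ≤ δ} := by
    ext U; simp only [Set.mem_setOf_eq, Set.mem_iInter]
  rw [h]
  exact isClosed_biInter fun p _ => isClosed_le (continuous_dist1_SU2.comp (continuous_plaqHol_SU2 p)) continuous_const

/-- ★ **THE CLOSED SMALL-FIELD GUARD IS COMPACT**: `SU(2)` is compact, so is the finite product `GaugeField P j SU2 = (bonds → SU(2))`, and the closed guard is a closed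
subset.  This is what makes a compactness-produced radius uniform over the (1.74)-regular base fields of one Prop-1 instance.
[cite: Balaban1989LargeFieldI, (1.74) p.192, Prop. 1 p.194 (last clause); Balaban1985Variational, (7) p.278] -/
theorem isCompact_setOf_plaqLeOn (S : Set (Plaq P j)) (δ : ℝ) :
    IsCompact {U : GaugeField P j SU2 | ∀ p ∈ S, dist1 (GaugeField.plaqHol U p) ≤ δ} := by
  haveI : CompactSpace (GaugeField P j SU2) := inferInstanceAs (CompactSpace (PBond P j → SU2))
  exact (isClosed_setOf_plaqLeOn S δ).isCompact

/-- **A COMPACT-UNIFORM LETTER SPECIALISES TO THE CLOSED GUARD**: if a property `Q R V_k` holds with ONE radius `R > 0` for all `V_k` of ANY compact set inside the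
closed guard, then it holds with one radius for every `V_k` of the closed guard (the guard itself is compact, `isCompact_setOf_plaqLeOn`).
[cite: Balaban1989LargeFieldI, Prop. 1 p.194 (last clause); Balaban1985Variational, Prop. 9 (190) p.309] -/
theorem forall_of_forall_isCompact_subset (S : Set (Plaq P j)) (δ : ℝ) (Q : ℝ → GaugeField P j SU2 → Prop)
    (h : ∀ K : Set (GaugeField P j SU2), IsCompact K → (∀ Vk ∈ K, ∀ p ∈ S, dist1 (GaugeField.plaqHol Vk p) ≤ δ) →
      ∃ R : ℝ, 0 < R ∧ ∀ Vk ∈ K, Q R Vk) :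
    ∃ R : ℝ, 0 < R ∧ ∀ Vk : GaugeField P j SU2, (∀ p ∈ S, dist1 (GaugeField.plaqHol Vk p) ≤ δ) → Q R Vk := by
  obtain ⟨R, hR, hall⟩ := h {U : GaugeField P j SU2 | ∀ p ∈ S, dist1 (GaugeField.plaqHol U p) ≤ δ} (isCompact_setOf_plaqLeOn S δ)
    fun Vk hVk => hVk
  exact ⟨R, hR, fun Vk hVk => hall Vk hVk⟩

end ClosedGuard

/-! ## §2  Bookkeeping: a nonnegative upper bound over a finite index -/

section Finite

/-- A real family over a finite index type is bounded above by a nonnegative constant (empty index included; private plumbing for the `cJ` absorption). [folklore] -/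
private theorem exists_forall_le_of_finite {ι : Type*} [Finite ι] (t : ι → ℝ) : ∃ c : ℝ, 0 ≤ c ∧ ∀ i, t i ≤ c := by
  rcases isEmpty_or_nonempty ι with h | h
  · exact ⟨0, le_rfl, fun i => (IsEmpty.false i).elim⟩
  · obtain ⟨i₀, hi₀⟩ := Finite.exists_max t
    exact ⟨max 0 (t i₀), le_max_left _ _, fun i => (hi₀ i).trans (le_max_right _ _)⟩

end Finite

/-! ## §3  The endpoints with the compact-uniform letter (J0′) on the closed guard, `R` existential, `cJ` absorbed -/

section Uniform


/-- ★★★ **PROPOSITION 1 [IV] AT PRINT'S (1.74) OBJECT — ONE-SIDED (1.7) EDITION — WITH THE CONFIGURATION LETTER (J0′) IN COMPACT-UNIFORM FORM.**  dag-n12-w1's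
`B15Prop1JointHolomorphyFromMinimiserFamilyOneSided.…_ofMinimiserFamily_oneSided` (p589595) VERBATIM but: (a) the letter `hMin` is replaced by `hMinK` — per instance `i`,
SOME radius `R > 0` such that for EVERY base field `V_k` of the CLOSED guard `|V_k(∂p) − 1| ≤ eR i` (`p` a plaquette in `Z ∖ Λ` up to scale `k`) one family of bond
matrices on the sup-ball `ball 0 R`, entrywise ℂ-differentiable, bounded by `𝓐₀ i`, equal at every real `(p, B′)` to SOME (2.12) minimiser of that point's datum in the class of
record (print's `U_k(V′)`, [15] Prop. 9 (190); «analytic function of B′ … e.g. |B′| < ε», [IV] p. 194) — the shape the compactness route delivers (§4); (b) the radius `R` is no longer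
a binder but PRODUCED (`∃ R` in the conclusion, inside the analyticity radius of the carrier `InstOn.std` exactly as before); (c) the bookkeeping letter `hcJ'` and the constant
`cJ` are REMOVED — with `[Finite ι]` (one finite lattice carries finitely many Prop-1 instances) `cJ := max_i (2cA·eR i∕R i + 4|Plaq|(1+8(𝓐₀ i)⁴)∕(R i·eR i))` is chosen
inside.  Every other binder ((L2) `h17`∕`hsm`∕`hγle`, `hfar`, (Gᵃ) `hZblk`, `hM2`∕`hdiv`, constants, [15] Thm 1 `h15T`) VERBATIM.
[cite: Balaban1989LargeFieldI, (1.74) p.192, Prop. 1 (1.77)–(1.78) p.194 (incl. the last clause), (1.79) p.195; Balaban1989LargeFieldII, (1.7)–(1.9) p.358, (1.12)–(1.13) p.359;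
Balaban1985Variational, (7) p.278, Thm 1 (8) p.279, Prop. 9 (190) p.309; Balaban1988Convergent, (2.12)–(2.14) pp.256–257] -/
theorem exists_domain_prop1Printed_lfVarOn_std_su2_box_intrinsic_analytic_atZSeqCoPRecord_ofThm1TorusClass_ofMinimiserFamilyUniform_oneSided {F : T4Family}
    (ν : Node00.Stage7Numerics) (Kt : ℕ) (hd3 : 3 ≤ (F.P Kt).d) (h0 : 0 < (F.P Kt).d) {ι : Type} [Finite ι]
    [hdec : ∀ j, DecidableEq (PBond (F.P Kt) j)] (hcl : hdec = fun _ a b => Classical.propDecidable (a = b))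
    (Z Λ : ι → Set (Site (F.P Kt) 0)) (k : ι → ℕ) (M : ι → ℝ) (hk0 : ∀ i, 0 < k i) (hk : ∀ i, k i ≤ (F.P Kt).m + (F.P Kt).K)
    (eR : ι → ℝ) (heR : ∀ i, 0 < eR i)
    (T : ∀ i, Finset (PBond (F.P Kt) (k i)))
    (lo hi : ι → Fin (F.P Kt).d → ℤ) (n : ι → ℕ) (hn : ∀ i κ, hi i κ ≤ lo i κ + n i) (hN : ∀ i, n i + 2 < (F.P Kt).sitesPerDir (k i))
    (hbox : ∀ i, pts (k i) (Λ i) = (castSite '' Set.Icc (lo i) (hi i) : Set (Site (F.P Kt) (k i))))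
    (hZ : ∀ i, (boxPlaqs (lo i - 1) (hi i + 1) : Set (Plaq (F.P Kt) (k i))) ⊆ plaqsInside (pts (k i) (Z i)))
    (hTG0 : ∀ i, T i = (box (fun κ => (hi i κ - lo i κ + 1).toNat) (lo i)).image fun x =>
      (⟨castSite (x - unitVec ⟨0, h0⟩), ⟨0, h0⟩⟩ : PBond (F.P Kt) (k i)))
    (hN5 : ∀ i κ, ((hi i κ - lo i κ + 1).toNat : ℤ) + 5 < (F.P Kt).sitesPerDir (k i))
    (K : ι → ℕ) (hK1 : ∀ i, 1 ≤ K i) (hKn : ∀ i κ, (hi i κ - lo i κ + 1).toNat ≤ K i)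
    (ext : ∀ i, GaugeField (F.P Kt) (k i) SU2 → GaugeField (F.P Kt) (k i) SU2)
    (hext : ∀ i Vk, ext i Vk = extend (pts (k i) (Λ i)) (shellGauge Vk (lo i) (hi i)) Vk)
    (hlohi : ∀ i, lo i ≤ hi i)
    {γ bx : ℝ} (hγ : 0 < γ) (hbx : 0 ≤ bx)
    (hbxM : ∀ i, 12 * ((F.P Kt).d : ℝ) * ((n i : ℝ) + 2) ^ 2 ≤ bx * (M i) ^ 2)
    {Cerr 𝓐₀ : ι → ℝ} (hM : ∀ i, 1 ≤ (M i))
    {γ₀ : ℝ} (hγ₀ : 0 ≤ γ₀)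
    -- (J0′) COMPACT-UNIFORM FORM ON THE CLOSED GUARD: per instance SOME radius `R > 0` serving every `V_k` with `|V_k(∂p) − 1| ≤ eR i` on `Z ∖ Λ` up to scale `k`
    (hMinK : ∀ i, ∃ R : ℝ, 0 < R ∧ ∀ Vk : GaugeField (F.P Kt) (k i) SU2,
      (∀ p ∈ plaqsInside (pts (k i) (Z i ∩ (Λ i)ᶜ)), dist1 (GaugeField.plaqHol Vk p) ≤ eR i) →
      ∃ Ũ : VecField (F.P Kt) (k i) (EuclideanSpace ℂ (Fin 3)) × VecField (F.P Kt) (k i) (EuclideanSpace ℂ (Fin 3)) →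
          PBond (F.P Kt) 0 → Matrix (Fin 2) (Fin 2) ℂ,
        (∀ b a c, DifferentiableOn ℂ (fun z => Ũ z b a c) (ball 0 R)) ∧
        (∀ z ∈ ball (0 : VecField (F.P Kt) (k i) (EuclideanSpace ℂ (Fin 3)) × VecField (F.P Kt) (k i) (EuclideanSpace ℂ (Fin 3))) R,
          ∀ b a c, ‖Ũ z b a c‖ ≤ 𝓐₀ i) ∧
        ∀ p B' : VecField (F.P Kt) (k i) E3, ‖p‖ < R → ‖B'‖ < R → ∃ U' : GaugeField (F.P Kt) 0 SU2,
          (∀ b, Ũ (cplxVec p, cplxVec B') b = ((U' b : SU2) : Matrix (Fin 2) (Fin 2) ℂ)) ∧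
            IsMinimizer (Node00.avOfRecord F 2 Kt) (Node00.regMSCoPOfRecord F 2 ν Kt (k i) (maxDomT ν.M₁ (Z i))) (Bj ν.M₁ (Z i) (k i))
              (avgFamily (Node00.avOfRecord F 2 Kt) (qsstarGIter0 (k i) (expMul su2Chart B' (ext i (expMul su2Chart p Vk))))) U')
    -- (L2) (1.7)–(1.9) p.358 for the Hessian of the slice function at `0`, one-sided, γ₀-generic
    (h17 : ∀ i Vk, PlaqSmallOn (plaqsInside (pts (k i) (Z i ∩ (Λ i)ᶜ))) (eR i) Vk → ∀ X : GaugeSlice (pts (k i) (Λ i)) (T i) E3,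
      γ₀ * (∑ z ∈ box (fun κ => (hi i κ - lo i κ + 1).toNat + 3) (fun κ => lo i κ - 2), ∑ μ : Fin (F.P Kt).d, ∑ a : Fin 3,
          curl (fun b => ιA (pts (k i) (Λ i)) (T i) X (⟨castSite b.1, b.2⟩ : PBond (F.P Kt) (k i)) a) z ⟨0, h0⟩ μ ^ 2) -
        Cerr i * ‖X‖ ^ 2 ≤ ⟪X, (fderiv ℝ (rGrad (pts (k i) (Λ i)) (T i)
              (sliceFn (pts (k i) (Λ i)) (T i)
                (fun177std (Node00.bgMSCoPOfRecord F 2 ν Kt (k i) (maxDomT ν.M₁ (Z i))) ν.M₁ (Z i) (k i)) (ext i Vk))) 0) X⟫)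
    (hsm : ∀ i, Cerr i ≤ γ₀ / (2 * (3 * (K i : ℝ) ^ 2 + 2 * (K i : ℝ) ^ 4)))
    (hγle : ∀ i, γ / (M i) ^ 5 ≤ γ₀ / (2 * (3 * (K i : ℝ) ^ 2 + 2 * (K i : ℝ) ^ 4)))
    -- the geometric letter: the k-blocks over the bonds meeting `Λ^{(k)}` lie inside `Ω₁(Z)`
    (hfar : ∀ i (b : PBond (F.P Kt) 0), b.src ∉ maxDomT ν.M₁ (Z i) 1 →
      (⟨blockIter (k i) b.src, b.dir⟩ : PBond (F.P Kt) (k i)) ∉ bondsOf (pts (k i) (Λ i)))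
    -- (Gᵃ) geometry of `Z`: a union of `k`-blocks
    (hZblk : ∀ i, IsBlockUnion (k i) (Z i))
    -- print's `M₁ ≥ 2` and the torus divisibility `L^{k}M₁ ∣ 2L^{m+K}`
    (hM2 : 2 ≤ ν.M₁) (hdiv : ∀ i, side (F.P Kt).L ν.M₁ (k i) ∣ (F.P Kt).sitesPerDir 0)
    -- bookkeeping constants
    {cE B₃ a₀ a₁' cA : ℝ} (hcE0 : 0 ≤ cE) (hcE : ∀ i, 12 * ((F.P Kt).d : ℝ) * ((n i : ℝ) + 2) ^ 2 ≤ cE) (hB₃ : 0 ≤ B₃)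
    (heRa : ∀ i, (cE + 1) * eR i ≤ a₁' ∧ B₃ * ((cE + 1) * eR i) ≤ ν.εreg) (ha₀ : ν.εreg ≤ a₀)
    (hcA : 1 / 2 * (B₃ * (cE + 1) * (F.P Kt).eta 1 ^ 2) ^ 2 * (Fintype.card (Plaq (F.P Kt) 0) : ℝ) ≤ cA)
    -- [15] THEOREM 1 (R), CLOSED GENERAL-SEQUENCE FORM, GUARDED, IN NODE 00's TORUS-NATIVE CLASS (shape (C)) — served by K0⁷'s def (n12-d 12Q⁵)
    (h15T : ∀ (k' : ℕ), k' ≤ (F.P Kt).m + (F.P Kt).K → side (F.P Kt).L ν.M₁ k' ∣ (F.P Kt).sitesPerDir 0 →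
      ∀ (s : B14.Eq218Concrete.Seq (fun n : ℕ => Node00.unionsOfCubes (F.P Kt) (side (F.P Kt).L ν.M₁ n)) k'),
      Node00.Sect2.SeqSeparated ν.M₁ s → 0 < ν.M₁ →
      ∀ (ε₀ : ℝ) (δ : ℕ → ℝ), (∀ j, j ≤ k' → 0 < δ j ∧ δ j ≤ a₁' ∧ B₃ * δ j ≤ ε₀) → (∀ j, j < k' → δ j ≤ 2 * δ (j + 1)) →
      (∀ j, j < k' → δ (j + 1) ≤ 2 * δ j) → ε₀ ≤ a₀ →
      ∀ W : MSField (F.P Kt) SU2,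
        Node00.Sect2.DataSmall7PTop (Node00.avOfRecord F 2 Kt) s.Ω (Node00.suppDomOfRecord F ν Kt s.Ω) k' δ W →
        ∀ U₀ : GaugeField (F.P Kt) 0 SU2, IsMinimizer (Node00.avOfRecord F 2 Kt)
            {U | (∀ j, j ≤ k' → PlaqSmallOn (Node00.Sect2.omegaPlaqsTop s.Ω (Node00.suppDomOfRecord F ν Kt s.Ω) j)
                (ε₀ * (F.P Kt).eta j ^ 2) U) ∧
              Node00.Sect2.CoDivClassOnTop s.Ω (Node00.suppDomOfRecord F ν Kt s.Ω) k' ε₀ U}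
            (genSet s.Ω k') W U₀ →
          (∀ j, j ≤ k' → PlaqSmallOn (Node00.Sect2.omegaPlaqsTop s.Ω (Node00.suppDomOfRecord F ν Kt s.Ω) j)
              (B₃ * δ j * (F.P Kt).eta j ^ 2) U₀) ∧
            ∀ j, j ≤ k' → Node00.Sect2.CoDivSmallOn (Node00.Sect2.omegaBondsTop s.Ω (Node00.suppDomOfRecord F ν Kt s.Ω) j)
              (B₃ * δ j * (F.P Kt).eta j ^ 3) U₀)
    : ∃ R : ι → ℝ, (∀ i, 0 < R i) ∧ ∃ a₁ : ι → ℝ, (∀ i, 0 < a₁ i) ∧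
      B15.Prop1Printed (lfVarOn su2Chart fun i =>
        InstOn.std (Node00.bgMSCoPOfRecord F 2 ν Kt (k i) (maxDomT ν.M₁ (Z i))) ν.M₁ (Z i) (Λ i) (k i) (M i) (a₁ i)
          (anExt (pts (k i) (Λ i)) (T i)
            (fun177std (Node00.bgMSCoPOfRecord F 2 ν Kt (k i) (maxDomT ν.M₁ (Z i))) ν.M₁ (Z i) (k i)) (ext i)
            (min (1 / 2) (min (R i / 8) (γ / (M i) ^ 5 * (R i / 2) ^ 2 /
              (48 * (4 * ((Fintype.card (Plaq (F.P Kt) 0) : ℝ) * (1 + 8 * 𝓐₀ i ^ 4)) / R i + 1))))))) := by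
  -- the radii, per instance, on the closed guard
  choose R hR hRall using hMinK
  -- the current constant, uniformly over the finite index
  obtain ⟨cJ, hcJ, hcJ'⟩ := exists_forall_le_of_finite fun i =>
    2 * cA * eR i / R i + 4 * ((Fintype.card (Plaq (F.P Kt) 0) : ℝ) * (1 + 8 * 𝓐₀ i ^ 4)) / (R i * eR i)
  refine ⟨R, hR, ?_⟩
  exact exists_domain_prop1Printed_lfVarOn_std_su2_box_intrinsic_analytic_atZSeqCoPRecord_ofThm1TorusClass_ofMinimiserFamily_oneSided ν Kt hd3 h0 hcl
    Z Λ k M hk0 hk eR heR T lo hi n hn hN hbox hZ hTG0 hN5 K hK1 hKn ext hext hlohi hγ hcJ hbx hbxM hM hR hγ₀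
    (fun i Vk hV => hRall i Vk (plaqLeOn_of_plaqSmallOn hV)) h17 hsm hγle hfar hZblk hM2 hdiv hcE0 hcE hB₃ heRa ha₀ hcA h15T hcJ'

/-- ★★★ **THE TWO-SIDED TWIN**: dag-n12-w1's `B15Prop1JointHolomorphyFromMinimiserFamily.…_ofMinimiserFamily` (p586362; the Hessian letter (L2) as the two-sided
comparison `hlead` with the effective form (1.8)) with the same three changes — `hMinK` on the closed guard, `R` produced, `hcJ'`∕`cJ` removed under `[Finite ι]`.
[cite: Balaban1989LargeFieldI, (1.74) p.192, Prop. 1 (1.77)–(1.78) p.194 (incl. the last clause), (1.79) p.195; Balaban1989LargeFieldII, (1.7)–(1.9) p.358, (1.12)–(1.13) p.359;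
Balaban1985Variational, (7) p.278, Thm 1 (8) p.279, Prop. 9 (190) p.309; Balaban1988Convergent, (2.12)–(2.14) pp.256–257] -/
theorem exists_domain_prop1Printed_lfVarOn_std_su2_box_intrinsic_analytic_atZSeqCoPRecord_ofThm1TorusClass_ofMinimiserFamilyUniform {F : T4Family}
    (ν : Node00.Stage7Numerics) (Kt : ℕ) (hd3 : 3 ≤ (F.P Kt).d) (h0 : 0 < (F.P Kt).d) {ι : Type} [Finite ι]
    [hdec : ∀ j, DecidableEq (PBond (F.P Kt) j)] (hcl : hdec = fun _ a b => Classical.propDecidable (a = b))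
    (Z Λ : ι → Set (Site (F.P Kt) 0)) (k : ι → ℕ) (M : ι → ℝ) (hk0 : ∀ i, 0 < k i) (hk : ∀ i, k i ≤ (F.P Kt).m + (F.P Kt).K)
    (eR : ι → ℝ) (heR : ∀ i, 0 < eR i)
    (T : ∀ i, Finset (PBond (F.P Kt) (k i)))
    (lo hi : ι → Fin (F.P Kt).d → ℤ) (n : ι → ℕ) (hn : ∀ i κ, hi i κ ≤ lo i κ + n i) (hN : ∀ i, n i + 2 < (F.P Kt).sitesPerDir (k i))
    (hbox : ∀ i, pts (k i) (Λ i) = (castSite '' Set.Icc (lo i) (hi i) : Set (Site (F.P Kt) (k i))))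
    (hZ : ∀ i, (boxPlaqs (lo i - 1) (hi i + 1) : Set (Plaq (F.P Kt) (k i))) ⊆ plaqsInside (pts (k i) (Z i)))
    (hTG0 : ∀ i, T i = (box (fun κ => (hi i κ - lo i κ + 1).toNat) (lo i)).image fun x =>
      (⟨castSite (x - unitVec ⟨0, h0⟩), ⟨0, h0⟩⟩ : PBond (F.P Kt) (k i)))
    (hN5 : ∀ i κ, ((hi i κ - lo i κ + 1).toNat : ℤ) + 5 < (F.P Kt).sitesPerDir (k i))
    (K : ι → ℕ) (hK1 : ∀ i, 1 ≤ K i) (hKn : ∀ i κ, (hi i κ - lo i κ + 1).toNat ≤ K i)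
    (ext : ∀ i, GaugeField (F.P Kt) (k i) SU2 → GaugeField (F.P Kt) (k i) SU2)
    (hext : ∀ i Vk, ext i Vk = extend (pts (k i) (Λ i)) (shellGauge Vk (lo i) (hi i)) Vk)
    (hlohi : ∀ i, lo i ≤ hi i)
    {γ bx : ℝ} (hγ : 0 < γ) (hbx : 0 ≤ bx)
    (hbxM : ∀ i, 12 * ((F.P Kt).d : ℝ) * ((n i : ℝ) + 2) ^ 2 ≤ bx * (M i) ^ 2)
    {Cerr 𝓐₀ : ι → ℝ} (hM : ∀ i, 1 ≤ (M i))
    (n' : ι → ℕ) (hn' : ∀ i, 1 ≤ n' i)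
    -- (J0′) COMPACT-UNIFORM FORM ON THE CLOSED GUARD
    (hMinK : ∀ i, ∃ R : ℝ, 0 < R ∧ ∀ Vk : GaugeField (F.P Kt) (k i) SU2,
      (∀ p ∈ plaqsInside (pts (k i) (Z i ∩ (Λ i)ᶜ)), dist1 (GaugeField.plaqHol Vk p) ≤ eR i) →
      ∃ Ũ : VecField (F.P Kt) (k i) (EuclideanSpace ℂ (Fin 3)) × VecField (F.P Kt) (k i) (EuclideanSpace ℂ (Fin 3)) →
          PBond (F.P Kt) 0 → Matrix (Fin 2) (Fin 2) ℂ,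
        (∀ b a c, DifferentiableOn ℂ (fun z => Ũ z b a c) (ball 0 R)) ∧
        (∀ z ∈ ball (0 : VecField (F.P Kt) (k i) (EuclideanSpace ℂ (Fin 3)) × VecField (F.P Kt) (k i) (EuclideanSpace ℂ (Fin 3))) R,
          ∀ b a c, ‖Ũ z b a c‖ ≤ 𝓐₀ i) ∧
        ∀ p B' : VecField (F.P Kt) (k i) E3, ‖p‖ < R → ‖B'‖ < R → ∃ U' : GaugeField (F.P Kt) 0 SU2,
          (∀ b, Ũ (cplxVec p, cplxVec B') b = ((U' b : SU2) : Matrix (Fin 2) (Fin 2) ℂ)) ∧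
            IsMinimizer (Node00.avOfRecord F 2 Kt) (Node00.regMSCoPOfRecord F 2 ν Kt (k i) (maxDomT ν.M₁ (Z i))) (Bj ν.M₁ (Z i) (k i))
              (avgFamily (Node00.avOfRecord F 2 Kt) (qsstarGIter0 (k i) (expMul su2Chart B' (ext i (expMul su2Chart p Vk))))) U')
    -- (L2) (1.7)–(1.9) p.358 for the Hessian of the slice function at `0`, two-sided
    (hlead : ∀ i Vk, PlaqSmallOn (plaqsInside (pts (k i) (Z i ∩ (Λ i)ᶜ))) (eR i) Vk →
      ∀ X : GaugeSlice (pts (k i) (Λ i)) (T i) E3,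
      |⟪X, (fderiv ℝ (rGrad (pts (k i) (Λ i)) (T i)
              (sliceFn (pts (k i) (Λ i)) (T i)
                (fun177std (Node00.bgMSCoPOfRecord F 2 ν Kt (k i) (maxDomT ν.M₁ (Z i))) ν.M₁ (Z i) (k i)) (ext i Vk))) 0) X⟫ -
          ∑ a : Fin 3, formDk (n' i) (fun _ : Fin (F.P Kt).d => (F.P Kt).sitesPerDir (k i))
            (ofRealCfg (fun _ : Fin (F.P Kt).d => (F.P Kt).sitesPerDir (k i)) fun j =>
              ιA (pts (k i) (Λ i)) (T i) X ⟨j.1, j.2⟩ a)| ≤ Cerr i * ‖X‖ ^ 2)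
    (hsm : ∀ i, Cerr i ≤ (4 / Real.pi ^ 2) ^ ((F.P Kt).d + 2) / (2 * (3 * (K i : ℝ) ^ 2 + 2 * (K i : ℝ) ^ 4)))
    (hγle : ∀ i, γ / (M i) ^ 5 ≤ (4 / Real.pi ^ 2) ^ ((F.P Kt).d + 2) / (2 * (3 * (K i : ℝ) ^ 2 + 2 * (K i : ℝ) ^ 4)))
    -- the geometric letter
    (hfar : ∀ i (b : PBond (F.P Kt) 0), b.src ∉ maxDomT ν.M₁ (Z i) 1 →
      (⟨blockIter (k i) b.src, b.dir⟩ : PBond (F.P Kt) (k i)) ∉ bondsOf (pts (k i) (Λ i)))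
    -- (Gᵃ) geometry of `Z`
    (hZblk : ∀ i, IsBlockUnion (k i) (Z i))
    (hM2 : 2 ≤ ν.M₁) (hdiv : ∀ i, side (F.P Kt).L ν.M₁ (k i) ∣ (F.P Kt).sitesPerDir 0)
    -- bookkeeping constants
    {cE B₃ a₀ a₁' cA : ℝ} (hcE0 : 0 ≤ cE) (hcE : ∀ i, 12 * ((F.P Kt).d : ℝ) * ((n i : ℝ) + 2) ^ 2 ≤ cE) (hB₃ : 0 ≤ B₃)
    (heRa : ∀ i, (cE + 1) * eR i ≤ a₁' ∧ B₃ * ((cE + 1) * eR i) ≤ ν.εreg) (ha₀ : ν.εreg ≤ a₀)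
    (hcA : 1 / 2 * (B₃ * (cE + 1) * (F.P Kt).eta 1 ^ 2) ^ 2 * (Fintype.card (Plaq (F.P Kt) 0) : ℝ) ≤ cA)
    -- [15] THEOREM 1 (R), shape (C), guarded
    (h15T : ∀ (k' : ℕ), k' ≤ (F.P Kt).m + (F.P Kt).K → side (F.P Kt).L ν.M₁ k' ∣ (F.P Kt).sitesPerDir 0 →
      ∀ (s : B14.Eq218Concrete.Seq (fun n : ℕ => Node00.unionsOfCubes (F.P Kt) (side (F.P Kt).L ν.M₁ n)) k'),
      Node00.Sect2.SeqSeparated ν.M₁ s → 0 < ν.M₁ →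
      ∀ (ε₀ : ℝ) (δ : ℕ → ℝ), (∀ j, j ≤ k' → 0 < δ j ∧ δ j ≤ a₁' ∧ B₃ * δ j ≤ ε₀) → (∀ j, j < k' → δ j ≤ 2 * δ (j + 1)) →
      (∀ j, j < k' → δ (j + 1) ≤ 2 * δ j) → ε₀ ≤ a₀ →
      ∀ W : MSField (F.P Kt) SU2,
        Node00.Sect2.DataSmall7PTop (Node00.avOfRecord F 2 Kt) s.Ω (Node00.suppDomOfRecord F ν Kt s.Ω) k' δ W →
        ∀ U₀ : GaugeField (F.P Kt) 0 SU2, IsMinimizer (Node00.avOfRecord F 2 Kt)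
            {U | (∀ j, j ≤ k' → PlaqSmallOn (Node00.Sect2.omegaPlaqsTop s.Ω (Node00.suppDomOfRecord F ν Kt s.Ω) j)
                (ε₀ * (F.P Kt).eta j ^ 2) U) ∧
              Node00.Sect2.CoDivClassOnTop s.Ω (Node00.suppDomOfRecord F ν Kt s.Ω) k' ε₀ U}
            (genSet s.Ω k') W U₀ →
          (∀ j, j ≤ k' → PlaqSmallOn (Node00.Sect2.omegaPlaqsTop s.Ω (Node00.suppDomOfRecord F ν Kt s.Ω) j)
              (B₃ * δ j * (F.P Kt).eta j ^ 2) U₀) ∧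
            ∀ j, j ≤ k' → Node00.Sect2.CoDivSmallOn (Node00.Sect2.omegaBondsTop s.Ω (Node00.suppDomOfRecord F ν Kt s.Ω) j)
              (B₃ * δ j * (F.P Kt).eta j ^ 3) U₀)
    : ∃ R : ι → ℝ, (∀ i, 0 < R i) ∧ ∃ a₁ : ι → ℝ, (∀ i, 0 < a₁ i) ∧
      B15.Prop1Printed (lfVarOn su2Chart fun i =>
        InstOn.std (Node00.bgMSCoPOfRecord F 2 ν Kt (k i) (maxDomT ν.M₁ (Z i))) ν.M₁ (Z i) (Λ i) (k i) (M i) (a₁ i)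
          (anExt (pts (k i) (Λ i)) (T i)
            (fun177std (Node00.bgMSCoPOfRecord F 2 ν Kt (k i) (maxDomT ν.M₁ (Z i))) ν.M₁ (Z i) (k i)) (ext i)
            (min (1 / 2) (min (R i / 8) (γ / (M i) ^ 5 * (R i / 2) ^ 2 /
              (48 * (4 * ((Fintype.card (Plaq (F.P Kt) 0) : ℝ) * (1 + 8 * 𝓐₀ i ^ 4)) / R i + 1))))))) := by
  choose R hR hRall using hMinK
  obtain ⟨cJ, hcJ, hcJ'⟩ := exists_forall_le_of_finite fun i =>
    2 * cA * eR i / R i + 4 * ((Fintype.card (Plaq (F.P Kt) 0) : ℝ) * (1 + 8 * 𝓐₀ i ^ 4)) / (R i * eR i)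
  refine ⟨R, hR, ?_⟩
  exact exists_domain_prop1Printed_lfVarOn_std_su2_box_intrinsic_analytic_atZSeqCoPRecord_ofThm1TorusClass_ofMinimiserFamily ν Kt hd3 h0 hcl
    Z Λ k M hk0 hk eR heR T lo hi n hn hN hbox hZ hTG0 hN5 K hK1 hKn ext hext hlohi hγ hcJ hbx hbxM hM hR n' hn'
    (fun i Vk hV => hRall i Vk (plaqLeOn_of_plaqSmallOn hV)) hlead hsm hγle hfar hZblk hM2 hdiv hcE0 hcE hB₃ heRa ha₀ hcA h15T hcJ'

end Uniform

/-! ## §4  The same with the letter in the compactness route's output shape -/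

section Compact


/-- ★★★ **PROPOSITION 1 [IV] AT PRINT'S (1.74) OBJECT — ONE-SIDED (1.7) EDITION — FROM THE COMPACTNESS ROUTE'S (J0′).**  §3 with the letter in the SHAPE the w1 lineage
delivers (`B15Prop1MinimiserFamilyPatching.hMin_of_localCharts`, `B15Prop1CriticalChartFromIFT.hMin_of_criticalFamilies`, and their successor from base-field letters):
`hMinC` — for every instance and EVERY COMPACT SET `K` of base fields inside the closed guard, ONE radius `R > 0` with the three clauses for all `V_k ∈ K`.  The closed
guard is itself compact (§1), so `hMinC` specialises to `hMinK`; a consumer holding the w1 theorem at fixed `𝓐₀ i` writes `fun i K hK _ => <w1 theorem> … hK …`.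
[cite: Balaban1989LargeFieldI, (1.74) p.192, Prop. 1 (1.77)–(1.78) p.194 (incl. the last clause), (1.79) p.195; Balaban1989LargeFieldII, (1.7)–(1.9) p.358, (1.12)–(1.13) p.359;
Balaban1985Variational, (7) p.278, Thm 1 (8) p.279, Prop. 9 (190) p.309; Balaban1988Convergent, (2.12)–(2.14) pp.256–257] -/
theorem exists_domain_prop1Printed_lfVarOn_std_su2_box_intrinsic_analytic_atZSeqCoPRecord_ofThm1TorusClass_ofMinimiserFamilyCompact_oneSided {F : T4Family}
    (ν : Node00.Stage7Numerics) (Kt : ℕ) (hd3 : 3 ≤ (F.P Kt).d) (h0 : 0 < (F.P Kt).d) {ι : Type} [Finite ι]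
    [hdec : ∀ j, DecidableEq (PBond (F.P Kt) j)] (hcl : hdec = fun _ a b => Classical.propDecidable (a = b))
    (Z Λ : ι → Set (Site (F.P Kt) 0)) (k : ι → ℕ) (M : ι → ℝ) (hk0 : ∀ i, 0 < k i) (hk : ∀ i, k i ≤ (F.P Kt).m + (F.P Kt).K)
    (eR : ι → ℝ) (heR : ∀ i, 0 < eR i)
    (T : ∀ i, Finset (PBond (F.P Kt) (k i)))
    (lo hi : ι → Fin (F.P Kt).d → ℤ) (n : ι → ℕ) (hn : ∀ i κ, hi i κ ≤ lo i κ + n i) (hN : ∀ i, n i + 2 < (F.P Kt).sitesPerDir (k i))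
    (hbox : ∀ i, pts (k i) (Λ i) = (castSite '' Set.Icc (lo i) (hi i) : Set (Site (F.P Kt) (k i))))
    (hZ : ∀ i, (boxPlaqs (lo i - 1) (hi i + 1) : Set (Plaq (F.P Kt) (k i))) ⊆ plaqsInside (pts (k i) (Z i)))
    (hTG0 : ∀ i, T i = (box (fun κ => (hi i κ - lo i κ + 1).toNat) (lo i)).image fun x =>
      (⟨castSite (x - unitVec ⟨0, h0⟩), ⟨0, h0⟩⟩ : PBond (F.P Kt) (k i)))
    (hN5 : ∀ i κ, ((hi i κ - lo i κ + 1).toNat : ℤ) + 5 < (F.P Kt).sitesPerDir (k i))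
    (K : ι → ℕ) (hK1 : ∀ i, 1 ≤ K i) (hKn : ∀ i κ, (hi i κ - lo i κ + 1).toNat ≤ K i)
    (ext : ∀ i, GaugeField (F.P Kt) (k i) SU2 → GaugeField (F.P Kt) (k i) SU2)
    (hext : ∀ i Vk, ext i Vk = extend (pts (k i) (Λ i)) (shellGauge Vk (lo i) (hi i)) Vk)
    (hlohi : ∀ i, lo i ≤ hi i)
    {γ bx : ℝ} (hγ : 0 < γ) (hbx : 0 ≤ bx)
    (hbxM : ∀ i, 12 * ((F.P Kt).d : ℝ) * ((n i : ℝ) + 2) ^ 2 ≤ bx * (M i) ^ 2)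
    {Cerr 𝓐₀ : ι → ℝ} (hM : ∀ i, 1 ≤ (M i))
    {γ₀ : ℝ} (hγ₀ : 0 ≤ γ₀)
    -- (J0′) IN THE COMPACTNESS ROUTE'S SHAPE: for every compact set of base fields inside the closed guard, ONE radius
    (hMinC : ∀ i (K : Set (GaugeField (F.P Kt) (k i) SU2)), IsCompact K →
      (∀ Vk ∈ K, ∀ p ∈ plaqsInside (pts (k i) (Z i ∩ (Λ i)ᶜ)), dist1 (GaugeField.plaqHol Vk p) ≤ eR i) →
      ∃ R : ℝ, 0 < R ∧ ∀ Vk ∈ K,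
      ∃ Ũ : VecField (F.P Kt) (k i) (EuclideanSpace ℂ (Fin 3)) × VecField (F.P Kt) (k i) (EuclideanSpace ℂ (Fin 3)) →
          PBond (F.P Kt) 0 → Matrix (Fin 2) (Fin 2) ℂ,
        (∀ b a c, DifferentiableOn ℂ (fun z => Ũ z b a c) (ball 0 R)) ∧
        (∀ z ∈ ball (0 : VecField (F.P Kt) (k i) (EuclideanSpace ℂ (Fin 3)) × VecField (F.P Kt) (k i) (EuclideanSpace ℂ (Fin 3))) R,
          ∀ b a c, ‖Ũ z b a c‖ ≤ 𝓐₀ i) ∧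
        ∀ p B' : VecField (F.P Kt) (k i) E3, ‖p‖ < R → ‖B'‖ < R → ∃ U' : GaugeField (F.P Kt) 0 SU2,
          (∀ b, Ũ (cplxVec p, cplxVec B') b = ((U' b : SU2) : Matrix (Fin 2) (Fin 2) ℂ)) ∧
            IsMinimizer (Node00.avOfRecord F 2 Kt) (Node00.regMSCoPOfRecord F 2 ν Kt (k i) (maxDomT ν.M₁ (Z i))) (Bj ν.M₁ (Z i) (k i))
              (avgFamily (Node00.avOfRecord F 2 Kt) (qsstarGIter0 (k i) (expMul su2Chart B' (ext i (expMul su2Chart p Vk))))) U')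
    -- (L2) one-sided, γ₀-generic
    (h17 : ∀ i Vk, PlaqSmallOn (plaqsInside (pts (k i) (Z i ∩ (Λ i)ᶜ))) (eR i) Vk → ∀ X : GaugeSlice (pts (k i) (Λ i)) (T i) E3,
      γ₀ * (∑ z ∈ box (fun κ => (hi i κ - lo i κ + 1).toNat + 3) (fun κ => lo i κ - 2), ∑ μ : Fin (F.P Kt).d, ∑ a : Fin 3,
          curl (fun b => ιA (pts (k i) (Λ i)) (T i) X (⟨castSite b.1, b.2⟩ : PBond (F.P Kt) (k i)) a) z ⟨0, h0⟩ μ ^ 2) -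
        Cerr i * ‖X‖ ^ 2 ≤ ⟪X, (fderiv ℝ (rGrad (pts (k i) (Λ i)) (T i)
              (sliceFn (pts (k i) (Λ i)) (T i)
                (fun177std (Node00.bgMSCoPOfRecord F 2 ν Kt (k i) (maxDomT ν.M₁ (Z i))) ν.M₁ (Z i) (k i)) (ext i Vk))) 0) X⟫)
    (hsm : ∀ i, Cerr i ≤ γ₀ / (2 * (3 * (K i : ℝ) ^ 2 + 2 * (K i : ℝ) ^ 4)))
    (hγle : ∀ i, γ / (M i) ^ 5 ≤ γ₀ / (2 * (3 * (K i : ℝ) ^ 2 + 2 * (K i : ℝ) ^ 4)))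
    (hfar : ∀ i (b : PBond (F.P Kt) 0), b.src ∉ maxDomT ν.M₁ (Z i) 1 →
      (⟨blockIter (k i) b.src, b.dir⟩ : PBond (F.P Kt) (k i)) ∉ bondsOf (pts (k i) (Λ i)))
    (hZblk : ∀ i, IsBlockUnion (k i) (Z i))
    (hM2 : 2 ≤ ν.M₁) (hdiv : ∀ i, side (F.P Kt).L ν.M₁ (k i) ∣ (F.P Kt).sitesPerDir 0)
    {cE B₃ a₀ a₁' cA : ℝ} (hcE0 : 0 ≤ cE) (hcE : ∀ i, 12 * ((F.P Kt).d : ℝ) * ((n i : ℝ) + 2) ^ 2 ≤ cE) (hB₃ : 0 ≤ B₃)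
    (heRa : ∀ i, (cE + 1) * eR i ≤ a₁' ∧ B₃ * ((cE + 1) * eR i) ≤ ν.εreg) (ha₀ : ν.εreg ≤ a₀)
    (hcA : 1 / 2 * (B₃ * (cE + 1) * (F.P Kt).eta 1 ^ 2) ^ 2 * (Fintype.card (Plaq (F.P Kt) 0) : ℝ) ≤ cA)
    (h15T : ∀ (k' : ℕ), k' ≤ (F.P Kt).m + (F.P Kt).K → side (F.P Kt).L ν.M₁ k' ∣ (F.P Kt).sitesPerDir 0 →
      ∀ (s : B14.Eq218Concrete.Seq (fun n : ℕ => Node00.unionsOfCubes (F.P Kt) (side (F.P Kt).L ν.M₁ n)) k'),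
      Node00.Sect2.SeqSeparated ν.M₁ s → 0 < ν.M₁ →
      ∀ (ε₀ : ℝ) (δ : ℕ → ℝ), (∀ j, j ≤ k' → 0 < δ j ∧ δ j ≤ a₁' ∧ B₃ * δ j ≤ ε₀) → (∀ j, j < k' → δ j ≤ 2 * δ (j + 1)) →
      (∀ j, j < k' → δ (j + 1) ≤ 2 * δ j) → ε₀ ≤ a₀ →
      ∀ W : MSField (F.P Kt) SU2,
        Node00.Sect2.DataSmall7PTop (Node00.avOfRecord F 2 Kt) s.Ω (Node00.suppDomOfRecord F ν Kt s.Ω) k' δ W →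
        ∀ U₀ : GaugeField (F.P Kt) 0 SU2, IsMinimizer (Node00.avOfRecord F 2 Kt)
            {U | (∀ j, j ≤ k' → PlaqSmallOn (Node00.Sect2.omegaPlaqsTop s.Ω (Node00.suppDomOfRecord F ν Kt s.Ω) j)
                (ε₀ * (F.P Kt).eta j ^ 2) U) ∧
              Node00.Sect2.CoDivClassOnTop s.Ω (Node00.suppDomOfRecord F ν Kt s.Ω) k' ε₀ U}
            (genSet s.Ω k') W U₀ →
          (∀ j, j ≤ k' → PlaqSmallOn (Node00.Sect2.omegaPlaqsTop s.Ω (Node00.suppDomOfRecord F ν Kt s.Ω) j)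
              (B₃ * δ j * (F.P Kt).eta j ^ 2) U₀) ∧
            ∀ j, j ≤ k' → Node00.Sect2.CoDivSmallOn (Node00.Sect2.omegaBondsTop s.Ω (Node00.suppDomOfRecord F ν Kt s.Ω) j)
              (B₃ * δ j * (F.P Kt).eta j ^ 3) U₀)
    : ∃ R : ι → ℝ, (∀ i, 0 < R i) ∧ ∃ a₁ : ι → ℝ, (∀ i, 0 < a₁ i) ∧
      B15.Prop1Printed (lfVarOn su2Chart fun i =>
        InstOn.std (Node00.bgMSCoPOfRecord F 2 ν Kt (k i) (maxDomT ν.M₁ (Z i))) ν.M₁ (Z i) (Λ i) (k i) (M i) (a₁ i)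
          (anExt (pts (k i) (Λ i)) (T i)
            (fun177std (Node00.bgMSCoPOfRecord F 2 ν Kt (k i) (maxDomT ν.M₁ (Z i))) ν.M₁ (Z i) (k i)) (ext i)
            (min (1 / 2) (min (R i / 8) (γ / (M i) ^ 5 * (R i / 2) ^ 2 /
              (48 * (4 * ((Fintype.card (Plaq (F.P Kt) 0) : ℝ) * (1 + 8 * 𝓐₀ i ^ 4)) / R i + 1))))))) :=
  exists_domain_prop1Printed_lfVarOn_std_su2_box_intrinsic_analytic_atZSeqCoPRecord_ofThm1TorusClass_ofMinimiserFamilyUniform_oneSided ν Kt hd3 h0 hcl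
    Z Λ k M hk0 hk eR heR T lo hi n hn hN hbox hZ hTG0 hN5 K hK1 hKn ext hext hlohi hγ hbx hbxM hM hγ₀
    (fun i => forall_of_forall_isCompact_subset (plaqsInside (pts (k i) (Z i ∩ (Λ i)ᶜ))) (eR i) (fun R Vk =>
      ∃ Ũ : VecField (F.P Kt) (k i) (EuclideanSpace ℂ (Fin 3)) × VecField (F.P Kt) (k i) (EuclideanSpace ℂ (Fin 3)) →
          PBond (F.P Kt) 0 → Matrix (Fin 2) (Fin 2) ℂ,
        (∀ b a c, DifferentiableOn ℂ (fun z => Ũ z b a c) (ball 0 R)) ∧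
        (∀ z ∈ ball (0 : VecField (F.P Kt) (k i) (EuclideanSpace ℂ (Fin 3)) × VecField (F.P Kt) (k i) (EuclideanSpace ℂ (Fin 3))) R,
          ∀ b a c, ‖Ũ z b a c‖ ≤ 𝓐₀ i) ∧
        ∀ p B' : VecField (F.P Kt) (k i) E3, ‖p‖ < R → ‖B'‖ < R → ∃ U' : GaugeField (F.P Kt) 0 SU2,
          (∀ b, Ũ (cplxVec p, cplxVec B') b = ((U' b : SU2) : Matrix (Fin 2) (Fin 2) ℂ)) ∧
            IsMinimizer (Node00.avOfRecord F 2 Kt) (Node00.regMSCoPOfRecord F 2 ν Kt (k i) (maxDomT ν.M₁ (Z i))) (Bj ν.M₁ (Z i) (k i))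
              (avgFamily (Node00.avOfRecord F 2 Kt) (qsstarGIter0 (k i) (expMul su2Chart B' (ext i (expMul su2Chart p Vk))))) U')
      (hMinC i))
    h17 hsm hγle hfar hZblk hM2 hdiv hcE0 hcE hB₃ heRa ha₀ hcA h15T

/-- ★★★ **THE TWO-SIDED TWIN FROM THE COMPACTNESS ROUTE'S (J0′)**: §3's two-sided endpoint with the letter `hMinC` (every compact `K` inside the closed guard ⇒ one radius).
[cite: Balaban1989LargeFieldI, (1.74) p.192, Prop. 1 (1.77)–(1.78) p.194 (incl. the last clause), (1.79) p.195; Balaban1989LargeFieldII, (1.7)–(1.9) p.358, (1.12)–(1.13) p.359;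
Balaban1985Variational, (7) p.278, Thm 1 (8) p.279, Prop. 9 (190) p.309; Balaban1988Convergent, (2.12)–(2.14) pp.256–257] -/
theorem exists_domain_prop1Printed_lfVarOn_std_su2_box_intrinsic_analytic_atZSeqCoPRecord_ofThm1TorusClass_ofMinimiserFamilyCompact {F : T4Family}
    (ν : Node00.Stage7Numerics) (Kt : ℕ) (hd3 : 3 ≤ (F.P Kt).d) (h0 : 0 < (F.P Kt).d) {ι : Type} [Finite ι]
    [hdec : ∀ j, DecidableEq (PBond (F.P Kt) j)] (hcl : hdec = fun _ a b => Classical.propDecidable (a = b))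
    (Z Λ : ι → Set (Site (F.P Kt) 0)) (k : ι → ℕ) (M : ι → ℝ) (hk0 : ∀ i, 0 < k i) (hk : ∀ i, k i ≤ (F.P Kt).m + (F.P Kt).K)
    (eR : ι → ℝ) (heR : ∀ i, 0 < eR i)
    (T : ∀ i, Finset (PBond (F.P Kt) (k i)))
    (lo hi : ι → Fin (F.P Kt).d → ℤ) (n : ι → ℕ) (hn : ∀ i κ, hi i κ ≤ lo i κ + n i) (hN : ∀ i, n i + 2 < (F.P Kt).sitesPerDir (k i))
    (hbox : ∀ i, pts (k i) (Λ i) = (castSite '' Set.Icc (lo i) (hi i) : Set (Site (F.P Kt) (k i))))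
    (hZ : ∀ i, (boxPlaqs (lo i - 1) (hi i + 1) : Set (Plaq (F.P Kt) (k i))) ⊆ plaqsInside (pts (k i) (Z i)))
    (hTG0 : ∀ i, T i = (box (fun κ => (hi i κ - lo i κ + 1).toNat) (lo i)).image fun x =>
      (⟨castSite (x - unitVec ⟨0, h0⟩), ⟨0, h0⟩⟩ : PBond (F.P Kt) (k i)))
    (hN5 : ∀ i κ, ((hi i κ - lo i κ + 1).toNat : ℤ) + 5 < (F.P Kt).sitesPerDir (k i))
    (K : ι → ℕ) (hK1 : ∀ i, 1 ≤ K i) (hKn : ∀ i κ, (hi i κ - lo i κ + 1).toNat ≤ K i)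
    (ext : ∀ i, GaugeField (F.P Kt) (k i) SU2 → GaugeField (F.P Kt) (k i) SU2)
    (hext : ∀ i Vk, ext i Vk = extend (pts (k i) (Λ i)) (shellGauge Vk (lo i) (hi i)) Vk)
    (hlohi : ∀ i, lo i ≤ hi i)
    {γ bx : ℝ} (hγ : 0 < γ) (hbx : 0 ≤ bx)
    (hbxM : ∀ i, 12 * ((F.P Kt).d : ℝ) * ((n i : ℝ) + 2) ^ 2 ≤ bx * (M i) ^ 2)
    {Cerr 𝓐₀ : ι → ℝ} (hM : ∀ i, 1 ≤ (M i))
    (n' : ι → ℕ) (hn' : ∀ i, 1 ≤ n' i)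
    -- (J0′) IN THE COMPACTNESS ROUTE'S SHAPE
    (hMinC : ∀ i (K : Set (GaugeField (F.P Kt) (k i) SU2)), IsCompact K →
      (∀ Vk ∈ K, ∀ p ∈ plaqsInside (pts (k i) (Z i ∩ (Λ i)ᶜ)), dist1 (GaugeField.plaqHol Vk p) ≤ eR i) →
      ∃ R : ℝ, 0 < R ∧ ∀ Vk ∈ K,
      ∃ Ũ : VecField (F.P Kt) (k i) (EuclideanSpace ℂ (Fin 3)) × VecField (F.P Kt) (k i) (EuclideanSpace ℂ (Fin 3)) →
          PBond (F.P Kt) 0 → Matrix (Fin 2) (Fin 2) ℂ,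
        (∀ b a c, DifferentiableOn ℂ (fun z => Ũ z b a c) (ball 0 R)) ∧
        (∀ z ∈ ball (0 : VecField (F.P Kt) (k i) (EuclideanSpace ℂ (Fin 3)) × VecField (F.P Kt) (k i) (EuclideanSpace ℂ (Fin 3))) R,
          ∀ b a c, ‖Ũ z b a c‖ ≤ 𝓐₀ i) ∧
        ∀ p B' : VecField (F.P Kt) (k i) E3, ‖p‖ < R → ‖B'‖ < R → ∃ U' : GaugeField (F.P Kt) 0 SU2,
          (∀ b, Ũ (cplxVec p, cplxVec B') b = ((U' b : SU2) : Matrix (Fin 2) (Fin 2) ℂ)) ∧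
            IsMinimizer (Node00.avOfRecord F 2 Kt) (Node00.regMSCoPOfRecord F 2 ν Kt (k i) (maxDomT ν.M₁ (Z i))) (Bj ν.M₁ (Z i) (k i))
              (avgFamily (Node00.avOfRecord F 2 Kt) (qsstarGIter0 (k i) (expMul su2Chart B' (ext i (expMul su2Chart p Vk))))) U')
    -- (L2) two-sided
    (hlead : ∀ i Vk, PlaqSmallOn (plaqsInside (pts (k i) (Z i ∩ (Λ i)ᶜ))) (eR i) Vk →
      ∀ X : GaugeSlice (pts (k i) (Λ i)) (T i) E3,
      |⟪X, (fderiv ℝ (rGrad (pts (k i) (Λ i)) (T i)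
              (sliceFn (pts (k i) (Λ i)) (T i)
                (fun177std (Node00.bgMSCoPOfRecord F 2 ν Kt (k i) (maxDomT ν.M₁ (Z i))) ν.M₁ (Z i) (k i)) (ext i Vk))) 0) X⟫ -
          ∑ a : Fin 3, formDk (n' i) (fun _ : Fin (F.P Kt).d => (F.P Kt).sitesPerDir (k i))
            (ofRealCfg (fun _ : Fin (F.P Kt).d => (F.P Kt).sitesPerDir (k i)) fun j =>
              ιA (pts (k i) (Λ i)) (T i) X ⟨j.1, j.2⟩ a)| ≤ Cerr i * ‖X‖ ^ 2)
    (hsm : ∀ i, Cerr i ≤ (4 / Real.pi ^ 2) ^ ((F.P Kt).d + 2) / (2 * (3 * (K i : ℝ) ^ 2 + 2 * (K i : ℝ) ^ 4)))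
    (hγle : ∀ i, γ / (M i) ^ 5 ≤ (4 / Real.pi ^ 2) ^ ((F.P Kt).d + 2) / (2 * (3 * (K i : ℝ) ^ 2 + 2 * (K i : ℝ) ^ 4)))
    (hfar : ∀ i (b : PBond (F.P Kt) 0), b.src ∉ maxDomT ν.M₁ (Z i) 1 →
      (⟨blockIter (k i) b.src, b.dir⟩ : PBond (F.P Kt) (k i)) ∉ bondsOf (pts (k i) (Λ i)))
    (hZblk : ∀ i, IsBlockUnion (k i) (Z i))
    (hM2 : 2 ≤ ν.M₁) (hdiv : ∀ i, side (F.P Kt).L ν.M₁ (k i) ∣ (F.P Kt).sitesPerDir 0)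
    {cE B₃ a₀ a₁' cA : ℝ} (hcE0 : 0 ≤ cE) (hcE : ∀ i, 12 * ((F.P Kt).d : ℝ) * ((n i : ℝ) + 2) ^ 2 ≤ cE) (hB₃ : 0 ≤ B₃)
    (heRa : ∀ i, (cE + 1) * eR i ≤ a₁' ∧ B₃ * ((cE + 1) * eR i) ≤ ν.εreg) (ha₀ : ν.εreg ≤ a₀)
    (hcA : 1 / 2 * (B₃ * (cE + 1) * (F.P Kt).eta 1 ^ 2) ^ 2 * (Fintype.card (Plaq (F.P Kt) 0) : ℝ) ≤ cA)
    (h15T : ∀ (k' : ℕ), k' ≤ (F.P Kt).m + (F.P Kt).K → side (F.P Kt).L ν.M₁ k' ∣ (F.P Kt).sitesPerDir 0 →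
      ∀ (s : B14.Eq218Concrete.Seq (fun n : ℕ => Node00.unionsOfCubes (F.P Kt) (side (F.P Kt).L ν.M₁ n)) k'),
      Node00.Sect2.SeqSeparated ν.M₁ s → 0 < ν.M₁ →
      ∀ (ε₀ : ℝ) (δ : ℕ → ℝ), (∀ j, j ≤ k' → 0 < δ j ∧ δ j ≤ a₁' ∧ B₃ * δ j ≤ ε₀) → (∀ j, j < k' → δ j ≤ 2 * δ (j + 1)) →
      (∀ j, j < k' → δ (j + 1) ≤ 2 * δ j) → ε₀ ≤ a₀ →
      ∀ W : MSField (F.P Kt) SU2,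
        Node00.Sect2.DataSmall7PTop (Node00.avOfRecord F 2 Kt) s.Ω (Node00.suppDomOfRecord F ν Kt s.Ω) k' δ W →
        ∀ U₀ : GaugeField (F.P Kt) 0 SU2, IsMinimizer (Node00.avOfRecord F 2 Kt)
            {U | (∀ j, j ≤ k' → PlaqSmallOn (Node00.Sect2.omegaPlaqsTop s.Ω (Node00.suppDomOfRecord F ν Kt s.Ω) j)
                (ε₀ * (F.P Kt).eta j ^ 2) U) ∧
              Node00.Sect2.CoDivClassOnTop s.Ω (Node00.suppDomOfRecord F ν Kt s.Ω) k' ε₀ U}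
            (genSet s.Ω k') W U₀ →
          (∀ j, j ≤ k' → PlaqSmallOn (Node00.Sect2.omegaPlaqsTop s.Ω (Node00.suppDomOfRecord F ν Kt s.Ω) j)
              (B₃ * δ j * (F.P Kt).eta j ^ 2) U₀) ∧
            ∀ j, j ≤ k' → Node00.Sect2.CoDivSmallOn (Node00.Sect2.omegaBondsTop s.Ω (Node00.suppDomOfRecord F ν Kt s.Ω) j)
              (B₃ * δ j * (F.P Kt).eta j ^ 3) U₀)
    : ∃ R : ι → ℝ, (∀ i, 0 < R i) ∧ ∃ a₁ : ι → ℝ, (∀ i, 0 < a₁ i) ∧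
      B15.Prop1Printed (lfVarOn su2Chart fun i =>
        InstOn.std (Node00.bgMSCoPOfRecord F 2 ν Kt (k i) (maxDomT ν.M₁ (Z i))) ν.M₁ (Z i) (Λ i) (k i) (M i) (a₁ i)
          (anExt (pts (k i) (Λ i)) (T i)
            (fun177std (Node00.bgMSCoPOfRecord F 2 ν Kt (k i) (maxDomT ν.M₁ (Z i))) ν.M₁ (Z i) (k i)) (ext i)
            (min (1 / 2) (min (R i / 8) (γ / (M i) ^ 5 * (R i / 2) ^ 2 /
              (48 * (4 * ((Fintype.card (Plaq (F.P Kt) 0) : ℝ) * (1 + 8 * 𝓐₀ i ^ 4)) / R i + 1))))))) :=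
  exists_domain_prop1Printed_lfVarOn_std_su2_box_intrinsic_analytic_atZSeqCoPRecord_ofThm1TorusClass_ofMinimiserFamilyUniform ν Kt hd3 h0 hcl
    Z Λ k M hk0 hk eR heR T lo hi n hn hN hbox hZ hTG0 hN5 K hK1 hKn ext hext hlohi hγ hbx hbxM hM n' hn'
    (fun i => forall_of_forall_isCompact_subset (plaqsInside (pts (k i) (Z i ∩ (Λ i)ᶜ))) (eR i) (fun R Vk =>
      ∃ Ũ : VecField (F.P Kt) (k i) (EuclideanSpace ℂ (Fin 3)) × VecField (F.P Kt) (k i) (EuclideanSpace ℂ (Fin 3)) →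
          PBond (F.P Kt) 0 → Matrix (Fin 2) (Fin 2) ℂ,
        (∀ b a c, DifferentiableOn ℂ (fun z => Ũ z b a c) (ball 0 R)) ∧
        (∀ z ∈ ball (0 : VecField (F.P Kt) (k i) (EuclideanSpace ℂ (Fin 3)) × VecField (F.P Kt) (k i) (EuclideanSpace ℂ (Fin 3))) R,
          ∀ b a c, ‖Ũ z b a c‖ ≤ 𝓐₀ i) ∧
        ∀ p B' : VecField (F.P Kt) (k i) E3, ‖p‖ < R → ‖B'‖ < R → ∃ U' : GaugeField (F.P Kt) 0 SU2,
          (∀ b, Ũ (cplxVec p, cplxVec B') b = ((U' b : SU2) : Matrix (Fin 2) (Fin 2) ℂ)) ∧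
            IsMinimizer (Node00.avOfRecord F 2 Kt) (Node00.regMSCoPOfRecord F 2 ν Kt (k i) (maxDomT ν.M₁ (Z i))) (Bj ν.M₁ (Z i) (k i))
              (avgFamily (Node00.avOfRecord F 2 Kt) (qsstarGIter0 (k i) (expMul su2Chart B' (ext i (expMul su2Chart p Vk))))) U')
      (hMinC i))
    hlead hsm hγle hfar hZblk hM2 hdiv hcE0 hcE hB₃ heRa ha₀ hcA h15T

end Compact

end Literature.MathematicalPhysics.QuantumFieldTheory.Balaban1983to89.B15Prop1ClosedGuardUniformRadius

end
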